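import Mathlib
import HarnessLib
import HarnessLib.Audit
import Summits.AtomisticToContinuum.Statement

/-!
Route: GolfBallGas

CLOSED (retired) 2026-08-15T13:42:51Z by operator:999:1257524 — reason: not-a-thesis: assembly does not conclude the sub-problem Statement — note: D-0027 §2.1 audit (human 2026-08-15: routes that do not decide the summit are removed): the assembly concludes `Literature.MathematicalPhysics.KineticTheory.HydrodynamicLimit`, not the sub-problem statement; a NEW conforming route may be opened from the same idea (generated `closes : … → _root_.Hydr. The file is kept as the record of this route; refuted decls are indexed as negative knowledge (`ledger negatives`).

# Route GolfBallGas — Golf-ball gas — grain microstructure derandomises each collision; Euler for a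
deterministic reversible near-spherical gas, then shape-stability of hydrodynamic laws gives the
conjunct

It suffices to show X = X₁ ∧ X₂ (card golf-ball-gas-dimple-dice, spine). Call a SHAPE SCHEDULE a
sequence Ψ_N : ℝ³ → ℝ³ of Borel-measurable, odd,
positively 1-homogeneous maps with (1−a_N)|r| ≤ |Ψ_N r| ≤ (1+a_N)|r| and angle(Ψ_N r, r) ≤ s_N, a_N,
s_N → 0 (ADMISSIBLE class: bodies C¹-close to the sphere up to o(1) normal jumps, edges allowed,
curvature free); the deterministic
SHAPE GAS is the configuration-space billiard of N+1 point particles on 𝕋³ with pair obstacle B_N =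
{r : |Ψ_N r| < ε_N} (ε_N = σ(N+1)^(-1/3), fixed reduced
density) and specular reflection about the direction Ψ_N(x_i − x_j) — typed WITHOUT new definitions
as `HardSphereFlow` of the modified geometry
sepVec x y := Ψ_N(reprSym(x−y)) (domain, contact set, incoming/outgoing and collidePair then read
off B_N and its normal); its local Gibbs law is
`particleLaw Φ' (canonicalDensity ⟨…Ψ_N…⟩ ε_N (N+1) (localGibbsProfile a₀ u₀ θ₀))`. X₁ =
ShapeGasEulerLimit: SOME admissible schedule (intended: golf
balls = sphere ∪ convex studs of width w_N ≤ ε_N e^(−N²) and slope s_N → 0 with s_N² N^(1/3) → ∞)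
has Liouville flows for every N and satisfies the
conclusion of the conjunct verbatim (local Gibbs data, LLN at t = 0 ⇒ LLN of density/momentum/energy
fields at every t < T of the classical
hard-sphere-Euler solution, ∃ σ₀(profiles)). X₂ = ShapeStability: for EVERY admissible schedule,
pre-shock MERGING of the laws of the hydrodynamic
observables of smooth spheres and of the shape gas (∫F(field) under the two evolved local Gibbs laws
differ by o(1) for bounded continuous F, all
t ∈ [0,T)). Assembly: X₁ gives Ψ; X₂ at t = 0 transfers the LLN hypothesis to the shape gas, X₁
evolves it, X₂ at t transfers it back (support
MergingTransfer, a bounded-continuous sandwich).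
Lean: `(∃ (Ψ : ℕ → Literature.MathematicalPhysics.KineticTheory.V3 →
Literature.MathematicalPhysics.KineticTheory.V3) (a s : ℕ → ℝ), ((∀ N, Measurable (Ψ N)) ∧ (∀ N r, Ψ
N (-r) = -Ψ N r) ∧ (∀ N (c : ℝ) r, 0 < c → Ψ N (c • r) = c • Ψ N r) ∧ (∀ N r, (1 - a N) * ‖r‖ ≤ ‖Ψ N
r‖ ∧ ‖Ψ N r‖ ≤ (1 + a N) * ‖r‖) ∧ (∀ N r, ‖(‖r‖) • Ψ N r - (‖Ψ N r‖) • r‖ ≤ s N * (‖r‖ * ‖Ψ N r‖)) ∧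
Filter.Tendsto a Filter.atTop (nhds 0) ∧ Filter.Tendsto s Filter.atTop (nhds 0)) ∧ ∀ (a₀ θ₀ :
Literature.MathematicalPhysics.KineticTheory.T3 → ℝ) (u₀ :
Literature.MathematicalPhysics.KineticTheory.T3 → Literature.MathematicalPhysics.KineticTheory.V3),
Continuous a₀ → Continuous θ₀ → Continuous u₀ → (∀ x, 0 < a₀ x) → (∀ x, 0 < θ₀ x) → ∃ σ₀ : ℝ, 0 < σ₀
∧ ∀ σ : ℝ, 0 < σ → σ < σ₀ → let G : ℕ → Literature.Analysis.FluidPDE.Geometry (Fin 3)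
Literature.MathematicalPhysics.KineticTheory.T3 := fun N =>
(⟨(Literature.Analysis.FluidPDE.Torus.geometry (Fin 3)).translate, fun x y => Ψ N
((Literature.Analysis.FluidPDE.Torus.geometry (Fin 3)).sepVec x y),
(Literature.Analysis.FluidPDE.Torus.geometry (Fin 3)).translate_zero,
(Literature.Analysis.FluidPDE.Torus.geometry (Fin 3)).translate_add⟩ :
Literature.Analysis.FluidPDE.Geometry (Fin 3) Literature.MathematicalPhysics.KineticTheory.T3); (∀
N, Nonempty (Literature.Analysis.FluidPDE.HardSphereFlow (G N)
(Literature.MathematicalPhysics.KineticTheory.hsDiameter σ N) (N + 1))) ∧ ∀ (T : ℝ) (ρ θ : ℝ →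
Literature.MathematicalPhysics.KineticTheory.T3 → ℝ) (u : ℝ →
Literature.MathematicalPhysics.KineticTheory.T3 → Literature.MathematicalPhysics.KineticTheory.V3),
Literature.MathematicalPhysics.KineticTheory.IsHardSphereEulerSolution σ T ρ u θ → ∀ Φ' : (N : ℕ) →
Literature.Analysis.FluidPDE.HardSphereFlow (G N)
(Literature.MathematicalPhysics.KineticTheory.hsDiameter σ N) (N + 1), let P' : (N : ℕ) →
MeasureTheory.Measure (Literature.Analysis.FluidPDE.Config (N + 1) (Fin 3)
Literature.MathematicalPhysics.KineticTheory.T3) := fun N =>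
Literature.Analysis.FluidPDE.particleLaw (Φ' N) (Literature.Analysis.FluidPDE.canonicalDensity (G N)
(Literature.MathematicalPhysics.KineticTheory.hsDiameter σ N) (N + 1)
(Literature.MathematicalPhysics.KineticTheory.localGibbsProfile a₀ u₀ θ₀)); (∀ χ :
Literature.MathematicalPhysics.KineticTheory.T3 → ℝ, Continuous χ → ∀ δ > (0 : ℝ), Filter.Tendsto
(fun N => P' N {z | δ < |Literature.MathematicalPhysics.KineticTheory.empiricalDensityField ((Φ'
N).flow 0 z) χ - ∫ x, χ x * ρ 0 x|}) Filter.atTop (nhds 0) ∧ Filter.Tendsto (fun N => P' N {z | δ <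
‖Literature.MathematicalPhysics.KineticTheory.empiricalMomentumField ((Φ' N).flow 0 z) χ - ∫ x, (χ x
* ρ 0 x) • u 0 x‖}) Filter.atTop (nhds 0) ∧ Filter.Tendsto (fun N => P' N {z | δ <
|Literature.MathematicalPhysics.KineticTheory.empiricalEnergyField ((Φ' N).flow 0 z) χ - ∫ x, χ x *
Literature.MathematicalPhysics.KineticTheory.totalEnergyDensity (ρ 0 x) (u 0 x) (θ 0 x)|})
Filter.atTop (nhds 0)) → ∀ t ∈ Set.Ico 0 T, (∀ χ : Literature.MathematicalPhysics.KineticTheory.T3 →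
ℝ, Continuous χ → ∀ δ > (0 : ℝ), Filter.Tendsto (fun N => P' N {z | δ <
|Literature.MathematicalPhysics.KineticTheory.empiricalDensityField ((Φ' N).flow t z) χ - ∫ x, χ x *
ρ t x|}) Filter.atTop (nhds 0) ∧ Filter.Tendsto (fun N => P' N {z | δ <
‖Literature.MathematicalPhysics.KineticTheory.empiricalMomentumField ((Φ' N).flow t z) χ - ∫ x, (χ x
* ρ t x) • u t x‖}) Filter.atTop (nhds 0) ∧ Filter.Tendsto (fun N => P' N {z | δ <
|Literature.MathematicalPhysics.KineticTheory.empiricalEnergyField ((Φ' N).flow t z) χ - ∫ x, χ x *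
Literature.MathematicalPhysics.KineticTheory.totalEnergyDensity (ρ t x) (u t x) (θ t x)|})
Filter.atTop (nhds 0))) ∧ (∀ (Ψ : ℕ → Literature.MathematicalPhysics.KineticTheory.V3 →
Literature.MathematicalPhysics.KineticTheory.V3) (a s : ℕ → ℝ), ((∀ N, Measurable (Ψ N)) ∧ (∀ N r, Ψ
N (-r) = -Ψ N r) ∧ (∀ N (c : ℝ) r, 0 < c → Ψ N (c • r) = c • Ψ N r) ∧ (∀ N r, (1 - a N) * ‖r‖ ≤ ‖Ψ N
r‖ ∧ ‖Ψ N r‖ ≤ (1 + a N) * ‖r‖) ∧ (∀ N r, ‖(‖r‖) • Ψ N r - (‖Ψ N r‖) • r‖ ≤ s N * (‖r‖ * ‖Ψ N r‖)) ∧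
Filter.Tendsto a Filter.atTop (nhds 0) ∧ Filter.Tendsto s Filter.atTop (nhds 0)) → ∀ (a₀ θ₀ :
Literature.MathematicalPhysics.KineticTheory.T3 → ℝ) (u₀ :
Literature.MathematicalPhysics.KineticTheory.T3 → Literature.MathematicalPhysics.KineticTheory.V3),
Continuous a₀ → Continuous θ₀ → Continuous u₀ → (∀ x, 0 < a₀ x) → (∀ x, 0 < θ₀ x) → ∃ σ₀ : ℝ, 0 < σ₀
∧ ∀ σ : ℝ, 0 < σ → σ < σ₀ → ∀ (T : ℝ) (ρ θ : ℝ → Literature.MathematicalPhysics.KineticTheory.T3 →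
ℝ) (u : ℝ → Literature.MathematicalPhysics.KineticTheory.T3 →
Literature.MathematicalPhysics.KineticTheory.V3),
Literature.MathematicalPhysics.KineticTheory.IsHardSphereEulerSolution σ T ρ u θ → ∀ Φ : (N : ℕ) →
Literature.Analysis.FluidPDE.HardSphereFlow (Literature.Analysis.FluidPDE.Torus.geometry (Fin 3))
(Literature.MathematicalPhysics.KineticTheory.hsDiameter σ N) (N + 1), let G : ℕ →
Literature.Analysis.FluidPDE.Geometry (Fin 3) Literature.MathematicalPhysics.KineticTheory.T3 := fun
N => (⟨(Literature.Analysis.FluidPDE.Torus.geometry (Fin 3)).translate, fun x y => Ψ N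
((Literature.Analysis.FluidPDE.Torus.geometry (Fin 3)).sepVec x y),
(Literature.Analysis.FluidPDE.Torus.geometry (Fin 3)).translate_zero,
(Literature.Analysis.FluidPDE.Torus.geometry (Fin 3)).translate_add⟩ :
Literature.Analysis.FluidPDE.Geometry (Fin 3) Literature.MathematicalPhysics.KineticTheory.T3); ∀ Φ'
: (N : ℕ) → Literature.Analysis.FluidPDE.HardSphereFlow (G N)
(Literature.MathematicalPhysics.KineticTheory.hsDiameter σ N) (N + 1),
Literature.MathematicalPhysics.KineticTheory.TendstoHydroFieldsAt (fun N =>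
Literature.MathematicalPhysics.KineticTheory.localGibbsLaw σ a₀ u₀ θ₀ N (Φ N)) Φ ρ u θ 0 → let P :
(N : ℕ) → MeasureTheory.Measure (Literature.Analysis.FluidPDE.Config (N + 1) (Fin 3)
Literature.MathematicalPhysics.KineticTheory.T3) := fun N =>
Literature.MathematicalPhysics.KineticTheory.localGibbsLaw σ a₀ u₀ θ₀ N (Φ N); let P' : (N : ℕ) →
MeasureTheory.Measure (Literature.Analysis.FluidPDE.Config (N + 1) (Fin 3)
Literature.MathematicalPhysics.KineticTheory.T3) := fun N =>
Literature.Analysis.FluidPDE.particleLaw (Φ' N) (Literature.Analysis.FluidPDE.canonicalDensity (G N)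
(Literature.MathematicalPhysics.KineticTheory.hsDiameter σ N) (N + 1)
(Literature.MathematicalPhysics.KineticTheory.localGibbsProfile a₀ u₀ θ₀)); ∀ t ∈ Set.Ico 0 T, ∀ χ :
Literature.MathematicalPhysics.KineticTheory.T3 → ℝ, Continuous χ → (∀ Fr : ℝ → ℝ, Continuous Fr →
(∃ M : ℝ, ∀ x, |Fr x| ≤ M) → Filter.Tendsto (fun N => (∫ z, Fr
(Literature.MathematicalPhysics.KineticTheory.empiricalDensityField ((Φ N).flow t z) χ) ∂(P N)) - ∫
z, Fr (Literature.MathematicalPhysics.KineticTheory.empiricalDensityField ((Φ' N).flow t z) χ) ∂(P'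
N)) Filter.atTop (nhds 0) ∧ Filter.Tendsto (fun N => (∫ z, Fr
(Literature.MathematicalPhysics.KineticTheory.empiricalEnergyField ((Φ N).flow t z) χ) ∂(P N)) - ∫
z, Fr (Literature.MathematicalPhysics.KineticTheory.empiricalEnergyField ((Φ' N).flow t z) χ) ∂(P'
N)) Filter.atTop (nhds 0)) ∧ (∀ Fv : Literature.MathematicalPhysics.KineticTheory.V3 → ℝ, Continuous
Fv → (∃ M : ℝ, ∀ v, |Fv v| ≤ M) → Filter.Tendsto (fun N => (∫ z, Fv
(Literature.MathematicalPhysics.KineticTheory.empiricalMomentumField ((Φ N).flow t z) χ) ∂(P N)) - ∫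
z, Fv (Literature.MathematicalPhysics.KineticTheory.empiricalMomentumField ((Φ' N).flow t z) χ) ∂(P'
N)) Filter.atTop (nhds 0)))`

## Assembly
Not pure logic but measure-theoretic glue (difficulty S–M): fix profiles; take Ψ, a, s and σ₁ from
ShapeGasEulerLimit, σ₂ from ShapeStability at
that schedule, σ₀ := min σ₁ σ₂. For σ < σ₀, a classical solution on [0,T), sphere flows Φ with the
LLN at t = 0 and t ∈ [0,T): choose shape flows
Φ'_N (nonempty by (i)); ShapeStability at t' = 0 plus MergingTransfer (with P := shape law, Q :=
sphere law; the laws are finite — normalised canonical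
densities — and z ↦ field(Φ_t z; χ) is measurable by `measurable_flow` and continuity of χ) turns
the sphere LLN at 0 into the shape LLN at 0;
ShapeGasEulerLimit (ii) evolves it to t; ShapeStability at t' = t plus MergingTransfer (P := sphere,
Q := shape) returns TendstoHydroFieldsAt for the
spheres at t, i.e. HydrodynamicLimit unfolded (hydrodynamicLimit_iff). Momentum: the ℝ³-valued half
of MergingTransfer.

Rationale: WHY THIS LINE. Everyone adds the dice by hand (OllaVaradhanYau1993 bulk velocity noise;
Rezakhanlou2003-type stochastic collision kernels; route VanishingNoise); the
golf ball MANUFACTURES them: a corrugation of the pair-exclusion body of width w ≪ ε and slope s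
makes the fine impact position ↦ outgoing normal an
EXPANDING map (factor s·ε/w), so one free flight's positional uncertainty δ ≫ w is converted into a
draw from a FIXED flux-reciprocal kernel k_s with total
variation error O(w/δ) — Feres' derivation of random (Knudsen) reflection operators from
deterministic wall microstructure (Feres2007, FeresYablonsky2004,
FeresZhang2012; rough-body scattering Plakhov2009), transplanted from one particle at a wall to PAIR
collisions in the N-body gas, with the abstract engine
filed as TwoScaleCellAveraging. Two twists found while scoping make the rung honest: (i) STUDS NOT
DIMPLES — with convex micro-scatterers the
configuration-space billiard stays semi-dispersing, so Alexander-type existence and the uniform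
collision bounds of BuragoFerlegerKononenko1998 are the
printed hard-ball theory, and (ii) w_N is free, so it can be taken super-exponentially small and the
exact coupling to the kernel gas HS(k_s) needs only
FINITE collision expectations, never an N^(4/3) bound. Imported areas: random billiards /
semi-dispersing billiard theory (dynamical systems), the OVY
relative-entropy architecture with conservative noise (probability), weak-merging of laws (measure
theory). What no prior route has: a deterministic,
reversible, Liouville, momentum- and energy-conserving hard-particle gas whose fixed-density Euler
limit reduces EXACTLY (pathwise coupling, no
law-level stability) to the stochastic rung the board rates reachable, and the conjunct isolated as
one clean statement — continuity of hydrodynamic-scale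
statistics in the grain shape at the sphere (ShapeStability) — instead of vanishing extraneous noise
(VanishingNoise 0811/0812) or hyperbolicity of free
flight (one-flight-standard-pairs-kac, anosov-rotor-spheres). Nearest printed derandomisation,
LampisPetrinaPetrina1999/Petrina2009, lets the whole
diameter vanish (Boltzmann–Grad); here ε/mean-free-path is fixed and only the sub-grain scale is
unresolved.

RANKED CRUXES. #2 ShapeGasEulerLimit (crux) — (card G1+G2+G3 bundled as one existential rung) there
is an admissible shape schedule (Ψ_N, a_N, s_N) such that for all continuous positive profiles ∃ σ₀
∀ σ ∈ (0,σ₀): (i) for every N the shape gas of N+1 particles at diameter σ(N+1)^(-1/3) admits a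
`HardSphereFlow` of the Ψ_N-geometry (Alexander's theorem for the studded body), and (ii) for every
classical hard-sphere-Euler solution on [0,T) and every family of such flows, if the shape-gas local
Gibbs fields converge in probability at t = 0 then they converge at every t < T (density, momentum,
energy; same format as HydrodynamicLimitFor). Intended witness: golf balls B_N = ball(ε_N) ∪ studs,
w_N ≤ ε_N e^(−N²), s_N = N^(−1/12); intended proof = KernelGasEulerLimit + ExactCoupling (informal
items, two-layer plan). [deps: TwoScaleCellAveraging] [difficulty: XL] (why it might fail: Reachable
only through the kernel-gas rung: an OVY-type Euler limit for HS(k_s) needs macro-ergodicity for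
CONTACT-localised kernel noise and Gaussian velocity tails with the true kinetic energy (NY II.1) —
both unproved; if that rung fails at fixed density no admissible shape helps.) [OllaVaradhanYau1993,
Feres2007, FeresZhang2012, BuragoFerlegerKononenko1998, Rezakhanlou2003, FritzFunakiLebowitz1994,
LiveraniOlla1996, ChernovDolgopyat2009]
#3 ShapeStability (crux) — (card G4, deterministic form) for EVERY admissible shape schedule, all
continuous positive profiles, ∃ σ₀ ∀ σ ∈ (0,σ₀), every classical hard-sphere-Euler solution on
[0,T), every family of sphere flows Φ and shape flows Φ': if the SPHERE local Gibbs fields converge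
at t = 0, then for every t ∈ [0,T), every continuous χ and every bounded continuous F,
E_sphere[F(density field_χ(t))] − E_shape[F(density field_χ(t))] → 0, likewise for the energy field
and, with bounded continuous F : ℝ³ → ℝ, for the momentum field (weak merging of the laws of the
hydrodynamic observables; t = 0 is the statics: same activity/velocity/temperature profiles,
exclusion bodies within relative Hausdorff distance a_N → 0). [difficulty: open-problem] (why it
might fail: Trajectories of the two gases decorrelate after one mean free time N^(-1/3) and no
law-level structural-stability theory exists; it is FALSE exactly if smooth spheres keep
non-hydrodynamic slow structure (fail macro-ergodicity) that every roughness destroys.)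
[OllaVaradhanYau1993, Spohn1991, Simanyi2013, CanestrariLiveraniOlla2026, LampisPetrinaPetrina1999,
BaladiDemersLiverani2017]
#9 MergingTransfer (support) — (assembly glue, pure measure theory on the (N+1)-particle phase
spaces) for finite measures P_N, Q_N and measurable real (resp. ℝ³-valued) observables X_N, Y_N: if
∫F(X_N)dP_N − ∫F(Y_N)dQ_N → 0 for every bounded continuous F and Y_N → c in Q_N-probability, then
X_N → c in P_N-probability (sandwich 1_(|x−c|>δ) ≤ F_δ ≤ 1_(|x−c|>δ/2)). [difficulty: provable-now]
[KipnisLandim1999, Folland1999]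
#9 TwoScaleCellAveraging (support) — (the derandomising engine, abstract Feres lemma) for a
ℤⁿ-periodic measurable cell map Tm on ℝⁿ (sup norm), |ψ| ≤ 1 measurable, and a density ρ that is
L-Lipschitz and vanishes outside the ball of radius R: |∫ ψ(Tm(x/h)) ρ(x) dx − (∫ρ)·∫_[0,1)ⁿ ψ∘Tm| ≤
2 L h (2R+3)ⁿ for 0 < h ≤ 1 — an observable of the h-rescaled microstructure seen through a density
Lipschitz at scale ≫ h is its cell average up to O(Lh). [difficulty: provable-now] [Feres2007,
FeresYablonsky2004, Plakhov2009]

TWO-LAYER PLAN. Foreseen glued split of the rank-2 crux once its objects are defined (definition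
request D1): ShapeGasEulerLimit ⇐ KernelGasEulerLimit →
ExactCoupling → ShapeGasEulerLimit, where KernelGasEulerLimit (filed informal, rank 4) = the
conclusion of HydrodynamicLimitFor σ, σ < σ₀(profiles), for
the stochastic-kernel hard-sphere gas HS(k_(s_N)) along slope schedules s_N → 0 with s_N² N^(1/3) →
∞ (OVY's weak-noise window: OllaVaradhanYau1993
Thm 1.1 transplanted to contact-localised, flux-reciprocal angular kernels with a Doeblin part;
shared in substance with VanishingNoise 0813/0811 and card
angular-noise-ladder), and ExactCoupling (filed informal, rank 5) = for the golf schedule with w_N ≤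
ε_N e^(−N²): golf gas and HS(k_(s_N)) from common
local Gibbs data live on one probability space with P(all collision partners, times and outcomes on
[0,t] coincide) → 1 (one-flight freshness of impact
parameters at scale ≫ w_N via TwoScaleCellAveraging + finite collision expectation via
BuragoFerlegerKononenko1998 + density ratio to equilibrium ≤
e^(CN)); the glue KernelGasEulerLimit → ExactCoupling → ShapeGasEulerLimit is a TV-transfer plus
Alexander's theorem for the studded body. Children of
ShapeStability, later: the statics half (t = 0: equality of the LLN density profiles of sphere and
shape local Gibbs states as a_N → 0, cluster
expansion) and the dynamic half; a finite-N rung "shape flow → HS(k_s) in law as w → 0, N fixed"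
(Feres' theorem for gases) rides with `--supports
ShapeGasEulerLimit`.

KILL CRITERIA. ShapeStability refuted (an admissible schedule with a different macroscopic limit at
some pre-shock time, or a theorem that rough gases thermalise
where smooth spheres provably do not) ⇒ `close --reason refuted:ShapeStability`; the rank-2 rung
survives only as a stand-alone theorem target and the
card is re-filed as a non-route rung. ShapeGasEulerLimit refuted for the golf class (e.g. Gaussian
velocity moments blow up along HS(k_s), or the
contact-localised Dirichlet form admits non-Gibbs translation-invariant zero-form states) ⇒ pivot:
restate with bulk-supported kernels (studs replaced by
a soft repulsive corrugated shell) or close refuted:ShapeGasEulerLimit if the stochastic rung itself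
dies (then VanishingNoise 0813 dies with it). If
VanishingNoise's 0812 (stochastic stability under vanishing noise) is refuted by a mechanism
insensitive to where the noise sits, ShapeStability is dead
in substance — close. HydrodynamicLimit proved elsewhere moots the route (the rung stays interesting
but is not this summit's business).

NOT DECOMPOSED YET. Deliberately NOT items at open: Alexander's theorem and the BFK collision-moment
bound for the studded body; the one-flight freshness lemma
(conditional impact-parameter densities Lipschitz at scale c·min(flight, ε) off an exceptional class
of probability O(w/ℓ)); Feres' finite-N
convergence-in-law theorem for gases; the statics of studded bodies (EOS = hard-sphere EOS + O(a_N),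
LLN of the shape local Gibbs law); the OVY entropy
inequality, contact currents and velocity-tail input inside KernelGasEulerLimit; the (h,s)
two-parameter family and its (U)-type uniformity variant.
All are layer-2 children or `--supports` lemmas once ShapeGasEulerLimit is split; constants (σ₀, the
Doeblin minorisation of k_s, the exceptional-class
exponents) are fixed there, not here.

CHEAPEST FALSIFIER. Paper-and-pencil, one day, refuters first: write the Dirichlet form of the
kernel gas HS(k_s) — it charges only the collision boundary |x_i − x_j| = ε
(codimension one in phase space). Check whether the Fritz–Funaki–Lebowitz / Liverani–Olla ergodic
step used by OVY (zero Dirichlet form ⇒ exchangeable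
velocities ⇒ Gibbs) goes through when the form only sees boundary traces (it needs: zero form ⇒
k_s-invariant contact traces ⇒ transport by free flight
spreads this to the bulk). If a translation-invariant, finite-entropy-density, NON-Gibbs state with
vanishing contact Dirichlet form can be written down
(e.g. a product state whose velocity law is k_s-invariant on every contact configuration but not
Maxwellian), KernelGasEulerLimit and hence the intended
proof of ShapeGasEulerLimit are dead. Second cheapest (kit, two-body): reflect off one studded
sphere with impact parameters drawn from densities
Lipschitz at scale δ ∈ {3w, 10w, 30w}; the outgoing-direction histogram must be δ-independent to
O(w/δ), flux-reciprocal, with an absolutely continuous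
part — not run here (kit not in this seat's payload).

NUMBERS. Fixed reduced density: (N+1)ε_N³ = σ³; collisions per particle per unit macroscopic time ≍
σ² N^(1/3), in total ≍ N^(4/3) t (Spohn1991 I.3). Golf
schedule: stud width w_N ≤ ε_N e^(−N²) (beats any collision-expectation bound
C(σ,profiles)^N·poly(N)); slope s_N → 0 with s_N² N^(1/3) → ∞ (OVY
window: noise per particle → ∞, randomised momentum transfer per collision → 0), e.g. s_N =
N^(−1/12); expanding factor of the impact-position ↦ normal
map s_N ε_N / w_N → ∞; per-collision coupling error O(w_N/δ) with δ ≍ min(preceding flight length,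
ε_N), typically ≍ ε_N since the mean free path ε_N/(πσ³·O(1)) exceeds ε_N at small σ; summed over ≍
N^(4/3) t collisions this is ≍ N^(4/3) e^(−N²) → 0, and exceptional flights shorter than C·w_N have
probability O(w_N σ³/ε_N) each.
Equation-of-state and exclusion-volume error O(a_N) with a_N ≤ s_N w_N/ε_N. Items at open: 5 typed
(2 cruxes, 2 supports, assembly) + 2 informal cruxes.

DEFINITION REQUESTS. D1 (`--kind definition --notion StochasticCollisionHardSphereProcess --topic
Literature/MathematicalPhysics/KineticTheory`): the kernel gas HS(k) —
N+1 point particles on 𝕋³ with pair exclusion at distance ε, free flight, and at each incoming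
contact of (i,j) with axis ω̂ and relative velocity g the
outgoing relative velocity |g|·n' with n' drawn from a Markov kernel k(dn' | ω̂, ĝ) on the outgoing
hemisphere, flux-reciprocal (detailed balance for
|⟨g,ω̂⟩| dω̂ ⊗ Maxwellian); law on path space / at time t as a measure on `Config (N+1) (Fin 3) T3`.
Shared with VanishingNoise (0811–0813, OVY noise is
the bulk analogue) and card angular-noise-ladder (HS(p)); needed to type KernelGasEulerLimit and
ExactCoupling. D2 (convenience, optional): a named
`shapeGeometry Ψ : Geometry (Fin 3) T3` (:= ⟨G₀.translate, Ψ ∘ G₀.sepVec, …⟩) in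
Literature/Analysis/FluidPDE would shorten every statement here; not
required (the anonymous constructor elaborates). Facts wanted as hypotheses (cite items, filed by
whoever proves ExactCoupling): Feres' random-billiard
limit theorem (Feres2007), the BFK uniform collision bound for semi-dispersing billiards
(BuragoFerlegerKononenko1998), the mean-free-path / boundary-flux
formula (Chernov1997).

Novelty: Searches (2026-08-15): `lit search --source crossref "random billiards microstructure Knudsen
reflection Feres"` (12: Feres2007, FeresYablonsky2004,
CookFeres2012, FeresZhang2012, ChumleyFeresGarciagerman2021, CoxFeres2016 — all one particle vs a
wall or two rigid bodies, no gas);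
`lit search --source crossref "rough hard spheres hydrodynamic limit deterministic gas Euler
equations stochastic collision kernel"` (12: found
Petrina2009 Ch. 2 / LampisPetrinaPetrina1999 "Stochastic dynamics as a limit of Hamiltonian dynamics
of hard spheres" — Boltzmann–Grad derandomisation,
diameter → 0; Bryan/rough-sphere kinetic theory = rotational roughness); `lit search --source
crossref "Lorentz gas rough scatterers random reflection
microstructure"` (10: nothing with pair collisions); `lit frontier AtomisticToContinuum --since
2020` (30 rows; relevant only CanestrariLiveraniOlla2026,
heat equation from a deterministic dynamics with internal chaotic degrees of freedom — diffusive
scale, other mechanism); `lit bridges AtomisticToContinuum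
--cross any` (30 rows, none relevant); openalex/arXiv rate-limited and `lit galaxy search "random
billiard" --star all` saturated at filing (the card's own
galaxy run of the same query recorded: Comets–Popov cosine-law billiards, nothing many-body); board:
135 cards of the sub read by title, related ones by
text (angular-noise-ladder, specular-lambertian-swap, one-flight-standard-pairs-kac,
anosov-rotor-spheres, einstein-bath-vanishing-solvent, flat-faces-p  [refs: Feres2007, FeresYablonsky2004, CookFeres2012, FeresZhang2012, ChumleyFeresGarciagerman2021, CoxFeres2016, Petrina2009, LampisPetrinaPetrina1999, CanestrariLiveraniOlla2026, OllaVaradhanYau1993]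

Barriers (technique_class: random-billiard exact-coupling relative-entropy): - technique_class: random-billiard exact-coupling relative-entropy
- Literature.Barriers.AtomisticToContinuum.BoltzmannHypothesisBarrier: applies to the intended proof
of ShapeGasEulerLimit only in its NOISY form (macro-ergodicity of the kernel gas HS(k_s), the
FFL/Liverani–Olla-type theorem-in-waiting for conservative contact noise); the deterministic golf
gas never meets it because the coupling to HS(k_s) is exact (pathwise), not a classification of its
invariant states; for the conjunct it returns in full inside ShapeStability — said plainly, that
crux is where the barrier lives.
- Literature.Barriers.AtomisticToContinuum.MacroErgodicityBarrier: same division — evaded for the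
rung exactly as OVY evade it (dynamics WITH conservative noise), bypassed for the golf gas by exact
coupling, NOT evaded for ShapeStability; the bet is that continuity in the grain shape is a weaker
demand than classifying invariant states of smooth spheres, because both gases share Liouville
measure, EOS limit and every conservation law and differ by a C^(0,1)-vanishing collision rule.
- Literature.Barriers.AtomisticToContinuum.HighMomentumCutoffBarrier: applies to KernelGasEulerLimit
(true kinetic energy |v|²/2, cubic energy current); not evaded — relocated to the stochastic rung,
where built-in angular averaging at every contact makes Povzner-type propagation of Gaussian
velocity moments the natural (unproved) input; the golf gas inherits whatever the rung proves
through ExactCoupling.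
- Literature

Novelty grade: new-combination — ROUTE REVIEW (refuter rreview 2026-08-15). STATE: not materialised (rev=0, no Theses file, no items); materialise first. Target X1∧X2 from the thesis elaborates rc0 (W1.lean). X1 ShapeGasEulerLimit: genuine exists-statement, no junk witness (admissibility forces a hard core of radius eps/(1+a_N) eve (refuter refuter-rreview-route-AtomisticToContinu-35415862-0, 2026-08-15T13:48:22Z; prior: Feres2007 doi:10.1017/cbo9780511755187.008, FeresZhang2012 doi:10.1007/s00220-012-1469-0, Plakhov2009 doi:10.1137/070709700, LampisPetrinaPetrina1999, OllaVaradhanYau1993, card audit refuter-novelty-audit-...-HydrodynamicLimit-7-0)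

History (route lifecycle, newest last):
- 2026-08-15T13:42:51Z · CLOSED retired — not-a-thesis: assembly does not conclude the sub-problem Statement (operator:999:1257524)

sub-problem: HydrodynamicLimit · status: closed(retired) · opened planner-plancard-AtomisticToContinuum-Hydrody-7288b72e-0 2026-08-15T11:45:28Z · rev 0 · ledger route-AtomisticToContinuum-GolfBallGas
GENERATED by the gate from the ledger (D-0016/17). Provers cite these decls: `theorem foo : Summit.AtomisticToContinuum.HydrodynamicLimit.Theses.GolfBallGas.<Decl> := …` in Summits/AtomisticToContinuum/HydrodynamicLimit/Theorems/<Name>.lean.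
-/

namespace Summit.AtomisticToContinuum.HydrodynamicLimit.Theses.GolfBallGas

open scoped BigOperators Topology Manifold Classical MeasureTheory ProbabilityTheory Matrix InnerProductSpace ComplexConjugate ContinuousMap
open Filter Set Function TopologicalSpace MeasureTheory

attribute [summit_statement] _root_.HydrodynamicLimit

/-- item stmt-AtomisticToContinuum-6277 · crux · rank 2 · closed · moot by None · by planner
why it might fail: Reachable only through the kernel-gas rung: an OVY-type Euler limit for HS(k_s) needs macro-ergodicity for CONTACT-localised kernel noise and Gaussian velocity tails with the true kinetic energy (NY II.1) — both unproved; if that rung fails at fixed density no admissible shape helps.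
sources: OllaVaradhanYau1993, Feres2007, FeresZhang2012, BuragoFerlegerKononenko1998, Rezakhanlou2003, FritzFunakiLebowitz1994
[crux] (card G1+G2+G3 bundled as one existential rung) there is an admissible shape schedule (Ψ_N,
a_N, s_N) such that for all continuous positive profiles ∃ σ₀ ∀ σ ∈ (0,σ₀): (i) for every N the
shape gas of N+1 particles at diameter σ(N+1)^(-1/3) admits a `HardSphereFlow` of the Ψ_N-geometry
(Alexander's theorem for the studded body), and (ii) for every classical hard-sphere-Euler solution
on [0,T) and every family of such flows, if the shape-gas local Gibbs fields converge in probability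
at t = 0 then they converge at every t < T (density, momentum, energy; same format as
HydrodynamicLimitFor). Intended witness: golf balls B_N = ball(ε_N) ∪ studs, w_N ≤ ε_N e^(−N²), s_N
= N^(−1/12); intended proof = KernelGasEulerLimit + ExactCoupling (informal items, two-layer plan).
[deps: TwoScaleCellAveraging] [difficulty: XL] -/
@[route_item "route-AtomisticToContinuum-GolfBallGas"]
def ShapeGasEulerLimit : Prop :=
  ∃ (Ψ : ℕ → Literature.MathematicalPhysics.KineticTheory.V3 → Literature.MathematicalPhysics.KineticTheory.V3) (a s : ℕ → ℝ), ((∀ N, Measurable (Ψ N)) ∧ (∀ N r, Ψ N (-r) = -Ψ N r) ∧ (∀ N (c : ℝ) r, 0 < c → Ψ N (c • r) = c • Ψ N r) ∧ (∀ N r, (1 - a N) * ‖r‖ ≤ ‖Ψ N r‖ ∧ ‖Ψ N r‖ ≤ (1 + a N) * ‖r‖) ∧ (∀ N r, ‖(‖r‖) • Ψ N r - (‖Ψ N r‖) • r‖ ≤ s N * (‖r‖ * ‖Ψ N r‖)) ∧ Filter.Tendsto a Filter.atTop (nhds 0) ∧ Filter.Tendsto s Filter.atTop (nhds 0)) ∧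 ∀ (a₀ θ₀ : Literature.MathematicalPhysics.KineticTheory.T3 → ℝ) (u₀ : Literature.MathematicalPhysics.KineticTheory.T3 → Literature.MathematicalPhysics.KineticTheory.V3), Continuous a₀ → Continuous θ₀ → Continuous u₀ → (∀ x, 0 < a₀ x) → (∀ x, 0 < θ₀ x) → ∃ σ₀ : ℝ, 0 < σ₀ ∧ ∀ σ : ℝ, 0 < σ → σ < σ₀ → let G : ℕ → Literature.Analysis.FluidPDE.Geometry (Fin 3) Literature.MathematicalPhysics.KineticTheory.T3 := fun N => (⟨(Literature.Analysis.FluidPDE.Torus.geometry (Fin 3)).translate, fun x y => Ψ N ((Literature.Analysis.FluidPDE.Torus.geometry (Fin 3)).sepVec x y), (Literature.Analysis.FluidPDE.Torus.geometry (Fin 3)).translate_zero, (Literature.Analysis.FluidPDE.Torus.geometry (Fin 3)).translate_add⟩ : Literature.Analysis.FluidPDE.Geometry (Fin 3) Literature.MathematicalPhysics.KineticTheory.T3); (∀ N, Nonempty (Literature.Analysis.FluidPDE.HardSphereFlow (G N) (Literature.MathematicalPhysics.KineticTheory.hsDiameter σ N) (N + 1))) ∧ ∀ (T : ℝ) (ρ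 θ : ℝ → Literature.MathematicalPhysics.KineticTheory.T3 → ℝ) (u : ℝ → Literature.MathematicalPhysics.KineticTheory.T3 → Literature.MathematicalPhysics.KineticTheory.V3), Literature.MathematicalPhysics.KineticTheory.IsHardSphereEulerSolution σ T ρ u θ → ∀ Φ' : (N : ℕ) → Literature.Analysis.FluidPDE.HardSphereFlow (G N) (Literature.MathematicalPhysics.KineticTheory.hsDiameter σ N) (N + 1), let P' : (N : ℕ) → MeasureTheory.Measure (Literature.Analysis.FluidPDE.Config (N + 1) (Fin 3) Literature.MathematicalPhysics.KineticTheory.T3) := fun N => Literature.Analysis.FluidPDE.particleLaw (Φ' N) (Literature.Analysis.FluidPDE.canonicalDensity (G N) (Literature.MathematicalPhysics.KineticTheory.hsDiameter σ N) (N + 1) (Literature.MathematicalPhysics.KineticTheory.localGibbsProfile a₀ u₀ θ₀)); (∀ χ : Literature.MathematicalPhysics.KineticTheory.T3 → ℝ, Continuous χ → ∀ δ > (0 : ℝ), Filter.Tendsto (fun N => P' N {z | δ < |Literature.MathematicalPhysics.KineticTheory.empiricalDensityField ((Φ' N).flow 0 z) χ - ∫ x, χ x * ρ 0 x|}) Filter.atTop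 (nhds 0) ∧ Filter.Tendsto (fun N => P' N {z | δ < ‖Literature.MathematicalPhysics.KineticTheory.empiricalMomentumField ((Φ' N).flow 0 z) χ - ∫ x, (χ x * ρ 0 x) • u 0 x‖}) Filter.atTop (nhds 0) ∧ Filter.Tendsto (fun N => P' N {z | δ < |Literature.MathematicalPhysics.KineticTheory.empiricalEnergyField ((Φ' N).flow 0 z) χ - ∫ x, χ x * Literature.MathematicalPhysics.KineticTheory.totalEnergyDensity (ρ 0 x) (u 0 x) (θ 0 x)|}) Filter.atTop (nhds 0)) → ∀ t ∈ Set.Ico 0 T, (∀ χ : Literature.MathematicalPhysics.KineticTheory.T3 → ℝ, Continuous χ → ∀ δ > (0 : ℝ), Filter.Tendsto (fun N => P' N {z | δ < |Literature.MathematicalPhysics.KineticTheory.empiricalDensityField ((Φ' N).flow t z) χ - ∫ x, χ x * ρ t x|}) Filter.atTop (nhds 0) ∧ Filter.Tendsto (fun N => P' N {z | δ < ‖Literature.MathematicalPhysics.KineticTheory.empiricalMomentumField ((Φ' N).flow t z) χ - ∫ x, (χ x * ρ t x) • u t x‖}) Filter.atTop (nhds 0) ∧ Filter.Tendsto (fun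 N => P' N {z | δ < |Literature.MathematicalPhysics.KineticTheory.empiricalEnergyField ((Φ' N).flow t z) χ - ∫ x, χ x * Literature.MathematicalPhysics.KineticTheory.totalEnergyDensity (ρ t x) (u t x) (θ t x)|}) Filter.atTop (nhds 0))

/-- item stmt-AtomisticToContinuum-6278 · crux · rank 3 · closed · moot by None · by planner
why it might fail: Trajectories of the two gases decorrelate after one mean free time N^(-1/3) and no law-level structural-stability theory exists; it is FALSE exactly if smooth spheres keep non-hydrodynamic slow structure (fail macro-ergodicity) that every roughness destroys.
sources: OllaVaradhanYau1993, Spohn1991, Simanyi2013, CanestrariLiveraniOlla2026, LampisPetrinaPetrina1999, BaladiDemersLiverani2017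
[crux] (card G4, deterministic form) for EVERY admissible shape schedule, all continuous positive
profiles, ∃ σ₀ ∀ σ ∈ (0,σ₀), every classical hard-sphere-Euler solution on [0,T), every family of
sphere flows Φ and shape flows Φ': if the SPHERE local Gibbs fields converge at t = 0, then for
every t ∈ [0,T), every continuous χ and every bounded continuous F, E_sphere[F(density field_χ(t))]
− E_shape[F(density field_χ(t))] → 0, likewise for the energy field and, with bounded continuous F :
ℝ³ → ℝ, for the momentum field (weak merging of the laws of the hydrodynamic observables; t = 0 is
the statics: same activity/velocity/temperature profiles, exclusion bodies within relative Hausdorff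
distance a_N → 0). [difficulty: open-problem] -/
@[route_item "route-AtomisticToContinuum-GolfBallGas"]
def ShapeStability : Prop :=
  ∀ (Ψ : ℕ → Literature.MathematicalPhysics.KineticTheory.V3 → Literature.MathematicalPhysics.KineticTheory.V3) (a s : ℕ → ℝ), ((∀ N, Measurable (Ψ N)) ∧ (∀ N r, Ψ N (-r) = -Ψ N r) ∧ (∀ N (c : ℝ) r, 0 < c → Ψ N (c • r) = c • Ψ N r) ∧ (∀ N r, (1 - a N) * ‖r‖ ≤ ‖Ψ N r‖ ∧ ‖Ψ N r‖ ≤ (1 + a N) * ‖r‖) ∧ (∀ N r, ‖(‖r‖) • Ψ N r - (‖Ψ N r‖) • r‖ ≤ s N * (‖r‖ * ‖Ψ N r‖)) ∧ Filter.Tendsto a Filter.atTop (nhds 0) ∧ Filter.Tendsto s Filter.atTop (nhds 0)) → ∀ (a₀ θ₀ : Literature.MathematicalPhysics.KineticTheory.T3 → ℝ) (u₀ : Literature.MathematicalPhysics.KineticTheory.T3 → Literature.MathematicalPhysics.KineticTheory.V3), Continuous a₀ → Continuous θ₀ → Continuous u₀ → (∀ x, 0 < a₀ x) → (∀ x, 0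 < θ₀ x) → ∃ σ₀ : ℝ, 0 < σ₀ ∧ ∀ σ : ℝ, 0 < σ → σ < σ₀ → ∀ (T : ℝ) (ρ θ : ℝ → Literature.MathematicalPhysics.KineticTheory.T3 → ℝ) (u : ℝ → Literature.MathematicalPhysics.KineticTheory.T3 → Literature.MathematicalPhysics.KineticTheory.V3), Literature.MathematicalPhysics.KineticTheory.IsHardSphereEulerSolution σ T ρ u θ → ∀ Φ : (N : ℕ) → Literature.Analysis.FluidPDE.HardSphereFlow (Literature.Analysis.FluidPDE.Torus.geometry (Fin 3)) (Literature.MathematicalPhysics.KineticTheory.hsDiameter σ N) (N + 1), let G : ℕ → Literature.Analysis.FluidPDE.Geometry (Fin 3) Literature.MathematicalPhysics.KineticTheory.T3 := fun N => (⟨(Literature.Analysis.FluidPDE.Torus.geometry (Fin 3)).translate, fun x y => Ψ N ((Literature.Analysis.FluidPDE.Torus.geometry (Fin 3)).sepVec x y), (Literature.Analysis.FluidPDE.Torus.geometry (Fin 3)).translate_zero, (Literature.Analysis.FluidPDE.Torus.geometry (Fin 3)).translate_add⟩ : Literature.Analysis.FluidPDE.Geometry (Fin 3) Literature.MathematicalPhysics.KineticTheory.T3);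 ∀ Φ' : (N : ℕ) → Literature.Analysis.FluidPDE.HardSphereFlow (G N) (Literature.MathematicalPhysics.KineticTheory.hsDiameter σ N) (N + 1), Literature.MathematicalPhysics.KineticTheory.TendstoHydroFieldsAt (fun N => Literature.MathematicalPhysics.KineticTheory.localGibbsLaw σ a₀ u₀ θ₀ N (Φ N)) Φ ρ u θ 0 → let P : (N : ℕ) → MeasureTheory.Measure (Literature.Analysis.FluidPDE.Config (N + 1) (Fin 3) Literature.MathematicalPhysics.KineticTheory.T3) := fun N => Literature.MathematicalPhysics.KineticTheory.localGibbsLaw σ a₀ u₀ θ₀ N (Φ N); let P' : (N : ℕ) → MeasureTheory.Measure (Literature.Analysis.FluidPDE.Config (N + 1) (Fin 3) Literature.MathematicalPhysics.KineticTheory.T3) := fun N => Literature.Analysis.FluidPDE.particleLaw (Φ' N) (Literature.Analysis.FluidPDE.canonicalDensity (G N) (Literature.MathematicalPhysics.KineticTheory.hsDiameter σ N) (N + 1) (Literature.MathematicalPhysics.KineticTheory.localGibbsProfile a₀ u₀ θ₀)); ∀ t ∈ Set.Ico 0 T, ∀ χ : Literature.MathematicalPhysics.KineticTheory.T3 → ℝ,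 Continuous χ → (∀ Fr : ℝ → ℝ, Continuous Fr → (∃ M : ℝ, ∀ x, |Fr x| ≤ M) → Filter.Tendsto (fun N => (∫ z, Fr (Literature.MathematicalPhysics.KineticTheory.empiricalDensityField ((Φ N).flow t z) χ) ∂(P N)) - ∫ z, Fr (Literature.MathematicalPhysics.KineticTheory.empiricalDensityField ((Φ' N).flow t z) χ) ∂(P' N)) Filter.atTop (nhds 0) ∧ Filter.Tendsto (fun N => (∫ z, Fr (Literature.MathematicalPhysics.KineticTheory.empiricalEnergyField ((Φ N).flow t z) χ) ∂(P N)) - ∫ z, Fr (Literature.MathematicalPhysics.KineticTheory.empiricalEnergyField ((Φ' N).flow t z) χ) ∂(P' N)) Filter.atTop (nhds 0)) ∧ (∀ Fv : Literature.MathematicalPhysics.KineticTheory.V3 → ℝ, Continuous Fv → (∃ M : ℝ, ∀ v, |Fv v| ≤ M) → Filter.Tendsto (fun N => (∫ z, Fv (Literature.MathematicalPhysics.KineticTheory.empiricalMomentumField ((Φ N).flow t z) χ) ∂(P N)) - ∫ z, Fv (Literature.MathematicalPhysics.KineticTheory.empiricalMomentumField ((Φ' N).flow t z) χ) ∂(P'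 N)) Filter.atTop (nhds 0))

-- item stmt-AtomisticToContinuum-7124 · support · rank 4 · closed · moot by None · by planner — informal only, no Lean statement yet:
--   [crux] KERNEL-GAS EULER LIMIT IN THE OVY WINDOW (card golf-ball-gas-dimple-dice G3; foreseen layer-2
--   child of ShapeGasEulerLimit, glue KernelGasEulerLimit → ExactCoupling → ShapeGasEulerLimit): for the
--   stochastic-kernel hard-sphere gas HS(k_s) — N+1 point particles on 𝕋³ with pair exclusion at ε_N =
--   σ(N+1)^(-1/3), free flight, and at each incoming contact of (i,j) with axis ω̂ and relative velocity
--   g the outgoing relative velocity |g|·n' with n' drawn from k_s(dn' | ω̂, ĝ), k_s flux-reciprocal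
--   (detailed balance for |⟨g,ω̂⟩|dω̂ ⊗ Maxwellian) with an absolutely continuous Doeblin part on a cone

-- item stmt-AtomisticToContinuum-7128 · support · rank 5 · closed · moot by None · by planner — informal only, no Lean statement yet:
--   [crux] EXACT COUPLING (card golf-ball-gas-dimple-dice G1+G2; foreseen layer-2 child of
--   ShapeGasEulerLimit): for the golf schedule B_N = ball(ε_N) ∪ convex studs of width w_N ≤ ε_N e^(−N²)
--   and slope s_N (Ψ_N = gauge × outward normal of B_N), σ ∈ (0,σ₀), continuous positive profiles and t
--   > 0: the golf-ball flow (HardSphereFlow of the Ψ_N-geometry) started from its local Gibbs law and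
--   the kernel gas HS(k_(s_N)) started from the same law can be realised on ONE probability space so
--   that P(every collision on [0,t] has the same partners, times and outgoing velocities in both
--   systems) → 1 as N → ∞; i

/-- item stmt-AtomisticToContinuum-6279 · support · rank 9 · closed · moot by None · by planner
sources: KipnisLandim1999, Folland1999
[support] (assembly glue, pure measure theory on the (N+1)-particle phase spaces) for finite
measures P_N, Q_N and measurable real (resp. ℝ³-valued) observables X_N, Y_N: if ∫F(X_N)dP_N −
∫F(Y_N)dQ_N → 0 for every bounded continuous F and Y_N → c in Q_N-probability, then X_N → c in
P_N-probability (sandwich 1_(|x−c|>δ) ≤ F_δ ≤ 1_(|x−c|>δ/2)). [difficulty: provable-now] -/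
@[route_item "route-AtomisticToContinuum-GolfBallGas"]
def MergingTransfer : Prop :=
  ∀ (P Q : (N : ℕ) → MeasureTheory.Measure (Literature.Analysis.FluidPDE.Config (N + 1) (Fin 3) Literature.MathematicalPhysics.KineticTheory.T3)), (∀ N, MeasureTheory.IsFiniteMeasure (P N)) → (∀ N, MeasureTheory.IsFiniteMeasure (Q N)) → (∀ (X Y : (N : ℕ) → Literature.Analysis.FluidPDE.Config (N + 1) (Fin 3) Literature.MathematicalPhysics.KineticTheory.T3 → ℝ) (c : ℝ), (∀ N, Measurable (X N)) → (∀ N, Measurable (Y N)) → (∀ Fr : ℝ → ℝ, Continuous Fr → (∃ M : ℝ, ∀ x, |Fr x| ≤ M) → Filter.Tendsto (fun N => (∫ z, Fr (X N z) ∂(P N)) - ∫ z, Fr (Y N z) ∂(Q N)) Filter.atTop (nhds 0)) → (∀ δ : ℝ, 0 < δ → Filter.Tendsto (fun N => Q N {z | δ < |Y N z - c|}) Filter.atTop (nhds 0)) → ∀ δ : ℝ, 0 < δ → Filter.Tendsto (fun N => P N {z | δ < |X N z - c|}) Filter.atTop (nhds 0)) ∧ (∀ (X Y : (N : ℕ)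 → Literature.Analysis.FluidPDE.Config (N + 1) (Fin 3) Literature.MathematicalPhysics.KineticTheory.T3 → Literature.MathematicalPhysics.KineticTheory.V3) (c : Literature.MathematicalPhysics.KineticTheory.V3), (∀ N, Measurable (X N)) → (∀ N, Measurable (Y N)) → (∀ Fv : Literature.MathematicalPhysics.KineticTheory.V3 → ℝ, Continuous Fv → (∃ M : ℝ, ∀ v, |Fv v| ≤ M) → Filter.Tendsto (fun N => (∫ z, Fv (X N z) ∂(P N)) - ∫ z, Fv (Y N z) ∂(Q N)) Filter.atTop (nhds 0)) → (∀ δ : ℝ, 0 < δ → Filter.Tendsto (fun N => Q N {z | δ < ‖Y N z - c‖}) Filter.atTop (nhds 0)) → ∀ δ : ℝ, 0 < δ → Filter.Tendsto (fun N => P N {z | δ < ‖X N z - c‖}) Filter.atTop (nhds 0))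

/-- item stmt-AtomisticToContinuum-6280 · support · rank 9 · closed · moot by None · by planner
sources: Feres2007, FeresYablonsky2004, Plakhov2009
[support] (the derandomising engine, abstract Feres lemma) for a ℤⁿ-periodic measurable cell map Tm
on ℝⁿ (sup norm), |ψ| ≤ 1 measurable, and a density ρ that is L-Lipschitz and vanishes outside the
ball of radius R: |∫ ψ(Tm(x/h)) ρ(x) dx − (∫ρ)·∫_[0,1)ⁿ ψ∘Tm| ≤ 2 L h (2R+3)ⁿ for 0 < h ≤ 1 — an
observable of the h-rescaled microstructure seen through a density Lipschitz at scale ≫ h is its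
cell average up to O(Lh). [difficulty: provable-now] -/
@[route_item "route-AtomisticToContinuum-GolfBallGas"]
def TwoScaleCellAveraging : Prop :=
  ∀ (n : ℕ) (Y : Type) (mY : MeasurableSpace Y) (Tm : (Fin n → ℝ) → Y), @Measurable (Fin n → ℝ) Y _ mY Tm → (∀ (y : Fin n → ℝ) (k : Fin n → ℤ), Tm (fun i => y i + k i) = Tm y) → ∀ ψ : Y → ℝ, @Measurable Y ℝ mY _ ψ → (∀ y, |ψ y| ≤ 1) → ∀ (ρ : (Fin n → ℝ) → ℝ) (L R h : ℝ), 0 ≤ L → 0 ≤ R → 0 < h → h ≤ 1 → LipschitzWith (Real.toNNReal L) ρ → (∀ x, R < ‖x‖ → ρ x = 0) → |(∫ x, ψ (Tm (h⁻¹ • x)) * ρ x) - (∫ x, ρ x) * ∫ y in Set.pi Set.univ (fun _ : Fin n => Set.Ico (0 : ℝ) 1), ψ (Tm y)| ≤ 2 * L * h * (2 * R + 3) ^ n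

/-- item stmt-AtomisticToContinuum-6281 · assembly · rank 1 · closed · moot by None · by planner
sources: Spohn1991, OllaVaradhanYau1993
[assembly] ShapeGasEulerLimit → ShapeStability → MergingTransfer → HydrodynamicLimit. -/
@[route_item "route-AtomisticToContinuum-GolfBallGas"]
def Assembly : Prop :=
  ShapeGasEulerLimit → ShapeStability → MergingTransfer → Literature.MathematicalPhysics.KineticTheory.HydrodynamicLimit

end Summit.AtomisticToContinuum.HydrodynamicLimit.Theses.GolfBallGas
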